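import Mathlib
import Summits.NavierStokesRegularity.NavierStokesRegularity.Theorems.EulerZoomLiouvillePowerGaugeEulerLiouvilleHoopSliceFrame

/-!
# K-HOOP (c)-analytic, part 2: the `σ`-integration — the chart-free hoop inequality on a box `[s₁, s₂] × [0, T] × [0, 2π]`
(seat ns-ezl-w2 g5; `--supports stmt-NavierStokesRegularity-19832 --as helper`; HOOP-NOTE dc156936fff7 §4)

Data: functions `a b c` of `(σ, t, θ)` (`= V_r, V_θ, V_z` along `axisPt σ t θ` in the smooth frame `rotZ θ e₀, rotZ θ e₁, e_z` — the
chart is ns-sfl-p1 g8's `…HoopSliceChart`), the frame derivatives `mr mθ mz` (`∂_θ a = t·mr + b`, `∂_θ b = t·mθ − a`, `∂_θ c = t·mz`),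
`ad = ∂_t a`, `aσ = ∂_σ a`, `cσ = ∂_σ c`, all jointly continuous, `a b c` `2π`-periodic in `θ`, the divergence relation
`ad + mθ + cσ = 0`, and a bound `|t⁻¹∫_θ(a² − b²)| ≤ M` on `[s₁, s₂] × (0, T]` (the hoop density is `O(1/t)`, ns-ezl-w3's
`exists_mul_abs_hoopDensity_le_solidCyl`).
* `hasDerivAt_pairing_sigma` — `∂_σ [π⁻¹(C_a C_c + S_a S_c)] = [π⁻¹(C_aσ C_c + S_aσ S_c)] + [π⁻¹(C_a C_cσ + S_a S_cσ)]`;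
* `pairing_sigma_ftc` — `∫_σ ∫_0^T (both brackets) dt dσ = U(s₂) − U(s₁)`, `U(s) = ∫_0^T π⁻¹(C_a C_c + S_a S_c)(s, t) dt`;
* **`hoop_box_le`** — `∫_σ ∫_0^T t⁻¹∫_θ (a² − b²) ≤ ∫_σ ∫_0^T t∫_θ (mr² + mθ² + aσ² + mz²) + ∫_σ E_σ(0) dσ + B(s₁) + B(s₂)`
  (`σ` over `[s₁, s₂]`), `E_σ(0) = π⁻¹((∫a σ 0 cos)² + (∫a σ 0 sin)²)` (AXIS ATOM, `= π‖V_⊥(σe_z)‖²`),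
  `B(s) = ∫_0^T∫_θ (a² + c²)(s, t, θ)` (END DISC, `= endFlux V s T`); the four squares are four of the nine entries of `t|DV|_F²`
  in the polar frame.  Proof: `hoop_slice_le_frame` per `σ`; the `β = cσ` term is `∫_θ P₁(a)·cσ = π⁻¹(C_a C_cσ + S_a S_cσ)`,
  integrated by parts in `σ` with `pairing_sigma_ftc`; ends by `two_mul_abs_pairing_le`, cross term by
  `two_mul_abs_pairing_deriv_le`; `−E_σ(T) ≤ 0` dropped.

HONEST FRAMING: calculus for the MODEL crux E (19832 OPEN); the geometric identification with `HoopCore.HoopInequality`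
(solid-cylinder integrals, `endFlux`, Frobenius majorisation) is NOT done here; nothing about NS regularity. [HOOP-NOTE §4; folklore]
-/

noncomputable section

open Set Filter Topology Metric Function MeasureTheory Real
open scoped Interval

set_option linter.dupNamespace false

namespace Summit.NavierStokesRegularity.NavierStokesRegularity.Theorems.PowerGaugeEulerLiouville.HoopCore

/-- Coefficient integrals `(σ, t) ↦ ∫₀^{2π} f σ t y · w y dy` of a jointly continuous `f` against a continuous weight are
jointly continuous (bookkeeping). -/
theorem continuous_coeff₂ {f : ℝ → ℝ → ℝ → ℝ} (hf : Continuous fun q : ℝ × ℝ × ℝ => f q.1 q.2.1 q.2.2) {w : ℝ → ℝ} (hw : Continuous w) :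
    Continuous fun p : ℝ × ℝ => ∫ y in (0 : ℝ)..2 * π, f p.1 p.2 y * w y :=
  continuous_parametric₂_intervalIntegral (F := fun σ t y => f σ t y * w y)
    (hf.mul (hw.comp (continuous_snd.comp continuous_snd))) _ _

/-- **The `σ`-derivative of the first-mode pairing** `W(σ, t) = π⁻¹(C_a C_c + S_a S_c)` (`C_f = ∫₀^{2π} f cos`, `S_f = ∫₀^{2π} f sin`;
`W = ∫_θ P₁(a)·c`): `∂_σ W = π⁻¹(C_aσ C_c + S_aσ S_c) + π⁻¹(C_a C_cσ + S_a S_cσ)`. -/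
theorem hasDerivAt_pairing_sigma {a c aσ cσ : ℝ → ℝ → ℝ → ℝ}
    (haσ : ∀ σ t θ, HasDerivAt (fun σ => a σ t θ) (aσ σ t θ) σ)
    (hcσ : ∀ σ t θ, HasDerivAt (fun σ => c σ t θ) (cσ σ t θ) σ)
    (hac : Continuous fun q : ℝ × ℝ × ℝ => a q.1 q.2.1 q.2.2) (hcc : Continuous fun q : ℝ × ℝ × ℝ => c q.1 q.2.1 q.2.2)
    (haσc : Continuous fun q : ℝ × ℝ × ℝ => aσ q.1 q.2.1 q.2.2) (hcσc : Continuous fun q : ℝ × ℝ × ℝ => cσ q.1 q.2.1 q.2.2) (σ t : ℝ) :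
    HasDerivAt (fun σ => π⁻¹ * (∫ y in (0 : ℝ)..2 * π, a σ t y * Real.cos y)
        * (∫ y in (0 : ℝ)..2 * π, c σ t y * Real.cos y) + π⁻¹
        * (∫ y in (0 : ℝ)..2 * π, a σ t y * Real.sin y) * (∫ y in (0 : ℝ)..2 * π, c σ t y * Real.sin y))
      ((π⁻¹ * (∫ y in (0 : ℝ)..2 * π, aσ σ t y * Real.cos y) * (∫ y in (0 : ℝ)..2 * π, c σ t y * Real.cos y)
          + π⁻¹ * (∫ y in (0 : ℝ)..2 * π, aσ σ t y * Real.sin y) * (∫ y in (0 : ℝ)..2 * π, c σ t y * Real.sin y)) +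
        (π⁻¹ * (∫ y in (0 : ℝ)..2 * π, a σ t y * Real.cos y) * (∫ y in (0 : ℝ)..2 * π, cσ σ t y * Real.cos y)
            + π⁻¹ * (∫ y in (0 : ℝ)..2 * π, a σ t y * Real.sin y)
            * (∫ y in (0 : ℝ)..2 * π, cσ σ t y * Real.sin y))) σ := by
  have hslc : ∀ {f : ℝ → ℝ → ℝ → ℝ}, (Continuous fun q : ℝ × ℝ × ℝ => f q.1 q.2.1 q.2.2) →
      Continuous (uncurry fun σ y => f σ t y) :=
    fun hf => hf.comp (by fun_prop : Continuous fun p : ℝ × ℝ => (p.1, t, p.2))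
  have hCa := hasDerivAt_intervalIntegral_mul_weight (a := fun σ y => a σ t y) (ad := fun σ y => aσ σ t y)
    (fun σ y => haσ σ t y) (hslc hac) (hslc haσc) continuous_cos σ
  have hSa := hasDerivAt_intervalIntegral_mul_weight (a := fun σ y => a σ t y) (ad := fun σ y => aσ σ t y)
    (fun σ y => haσ σ t y) (hslc hac) (hslc haσc) continuous_sin σ
  have hCc := hasDerivAt_intervalIntegral_mul_weight (a := fun σ y => c σ t y) (ad := fun σ y => cσ σ t y)
    (fun σ y => hcσ σ t y) (hslc hcc) (hslc hcσc) continuous_cos σ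
  have hSc := hasDerivAt_intervalIntegral_mul_weight (a := fun σ y => c σ t y) (ad := fun σ y => cσ σ t y)
    (fun σ y => hcσ σ t y) (hslc hcc) (hslc hcσc) continuous_sin σ
  have h := (((hCa.const_mul π⁻¹).mul hCc).add ((hSa.const_mul π⁻¹).mul hSc))
  refine h.congr_deriv ?_
  ring

/-- **FTC in `σ` for the pairing**: `∫_{s₁}^{s₂} ∫_0^T ∂_σW dt dσ = U(s₂) − U(s₁)`, `U(s) = ∫_0^T W(s, t) dt`
(differentiation under `∫_0^T dt` by `hasDerivAt_intervalIntegral_of_continuous`, then the fundamental theorem of calculus). -/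
theorem pairing_sigma_ftc {a c aσ cσ : ℝ → ℝ → ℝ → ℝ}
    (haσ : ∀ σ t θ, HasDerivAt (fun σ => a σ t θ) (aσ σ t θ) σ)
    (hcσ : ∀ σ t θ, HasDerivAt (fun σ => c σ t θ) (cσ σ t θ) σ)
    (hac : Continuous fun q : ℝ × ℝ × ℝ => a q.1 q.2.1 q.2.2) (hcc : Continuous fun q : ℝ × ℝ × ℝ => c q.1 q.2.1 q.2.2)
    (haσc : Continuous fun q : ℝ × ℝ × ℝ => aσ q.1 q.2.1 q.2.2) (hcσc : Continuous fun q : ℝ × ℝ × ℝ => cσ q.1 q.2.1 q.2.2) (s₁ s₂ T : ℝ) :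
    ∫ σ in s₁..s₂, ∫ t in (0 : ℝ)..T,
        ((π⁻¹ * (∫ y in (0 : ℝ)..2 * π, aσ σ t y * Real.cos y)
            * (∫ y in (0 : ℝ)..2 * π, c σ t y * Real.cos y) + π⁻¹
            * (∫ y in (0 : ℝ)..2 * π, aσ σ t y * Real.sin y) * (∫ y in (0 : ℝ)..2 * π, c σ t y * Real.sin y)) +
          (π⁻¹ * (∫ y in (0 : ℝ)..2 * π, a σ t y * Real.cos y)
              * (∫ y in (0 : ℝ)..2 * π, cσ σ t y * Real.cos y) + π⁻¹
              * (∫ y in (0 : ℝ)..2 * π, a σ t y * Real.sin y) * (∫ y in (0 : ℝ)..2 * π, cσ σ t y * Real.sin y))) =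
      (∫ t in (0 : ℝ)..T, (π⁻¹ * (∫ y in (0 : ℝ)..2 * π, a s₂ t y * Real.cos y)
          * (∫ y in (0 : ℝ)..2 * π, c s₂ t y * Real.cos y) + π⁻¹
          * (∫ y in (0 : ℝ)..2 * π, a s₂ t y * Real.sin y) * (∫ y in (0 : ℝ)..2 * π, c s₂ t y * Real.sin y))) -
        ∫ t in (0 : ℝ)..T, (π⁻¹ * (∫ y in (0 : ℝ)..2 * π, a s₁ t y * Real.cos y)
            * (∫ y in (0 : ℝ)..2 * π, c s₁ t y * Real.cos y) + π⁻¹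
            * (∫ y in (0 : ℝ)..2 * π, a s₁ t y * Real.sin y) * (∫ y in (0 : ℝ)..2 * π, c s₁ t y * Real.sin y)) := by
  -- joint continuity in `(σ, t)` of `W` and `∂_σ W`
  have hW : Continuous (uncurry fun σ t => π⁻¹ * (∫ y in (0 : ℝ)..2 * π, a σ t y * Real.cos y)
      * (∫ y in (0 : ℝ)..2 * π, c σ t y * Real.cos y) + π⁻¹ * (∫ y in (0 : ℝ)..2 * π, a σ t y * Real.sin y)
      * (∫ y in (0 : ℝ)..2 * π, c σ t y * Real.sin y)) := by
    have h1 := continuous_coeff₂ hac continuous_cos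
    have h2 := continuous_coeff₂ hcc continuous_cos
    have h3 := continuous_coeff₂ hac continuous_sin
    have h4 := continuous_coeff₂ hcc continuous_sin
    exact ((continuous_const.mul h1).mul h2).add ((continuous_const.mul h3).mul h4)
  have hW' : Continuous (uncurry fun σ t =>
      (π⁻¹ * (∫ y in (0 : ℝ)..2 * π, aσ σ t y * Real.cos y) * (∫ y in (0 : ℝ)..2 * π, c σ t y * Real.cos y)
          + π⁻¹ * (∫ y in (0 : ℝ)..2 * π, aσ σ t y * Real.sin y) * (∫ y in (0 : ℝ)..2 * π, c σ t y * Real.sin y)) +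
        (π⁻¹ * (∫ y in (0 : ℝ)..2 * π, a σ t y * Real.cos y) * (∫ y in (0 : ℝ)..2 * π, cσ σ t y * Real.cos y)
            + π⁻¹ * (∫ y in (0 : ℝ)..2 * π, a σ t y * Real.sin y)
            * (∫ y in (0 : ℝ)..2 * π, cσ σ t y * Real.sin y))) := by
    have h1 := continuous_coeff₂ haσc continuous_cos
    have h2 := continuous_coeff₂ hcc continuous_cos
    have h3 := continuous_coeff₂ haσc continuous_sin
    have h4 := continuous_coeff₂ hcc continuous_sin
    have h5 := continuous_coeff₂ hac continuous_cos
    have h6 := continuous_coeff₂ hcσc continuous_cos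
    have h7 := continuous_coeff₂ hac continuous_sin
    have h8 := continuous_coeff₂ hcσc continuous_sin
    exact (((continuous_const.mul h1).mul h2).add ((continuous_const.mul h3).mul h4)).add
      (((continuous_const.mul h5).mul h6).add ((continuous_const.mul h7).mul h8))
  have hU : ∀ σ, HasDerivAt (fun σ => ∫ t in (0 : ℝ)..T, (π⁻¹
      * (∫ y in (0 : ℝ)..2 * π, a σ t y * Real.cos y) * (∫ y in (0 : ℝ)..2 * π, c σ t y * Real.cos y) + π⁻¹
      * (∫ y in (0 : ℝ)..2 * π, a σ t y * Real.sin y) * (∫ y in (0 : ℝ)..2 * π, c σ t y * Real.sin y)))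
      (∫ t in (0 : ℝ)..T, ((π⁻¹ * (∫ y in (0 : ℝ)..2 * π, aσ σ t y * Real.cos y)
          * (∫ y in (0 : ℝ)..2 * π, c σ t y * Real.cos y) + π⁻¹
          * (∫ y in (0 : ℝ)..2 * π, aσ σ t y * Real.sin y) * (∫ y in (0 : ℝ)..2 * π, c σ t y * Real.sin y)) +
        (π⁻¹ * (∫ y in (0 : ℝ)..2 * π, a σ t y * Real.cos y) * (∫ y in (0 : ℝ)..2 * π, cσ σ t y * Real.cos y)
            + π⁻¹ * (∫ y in (0 : ℝ)..2 * π, a σ t y * Real.sin y)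
            * (∫ y in (0 : ℝ)..2 * π, cσ σ t y * Real.sin y)))) σ :=
    fun σ => hasDerivAt_intervalIntegral_of_continuous
      (F := fun σ t => π⁻¹ * (∫ y in (0 : ℝ)..2 * π, a σ t y * Real.cos y)
          * (∫ y in (0 : ℝ)..2 * π, c σ t y * Real.cos y) + π⁻¹
          * (∫ y in (0 : ℝ)..2 * π, a σ t y * Real.sin y) * (∫ y in (0 : ℝ)..2 * π, c σ t y * Real.sin y))
      (F' := fun σ t => (π⁻¹ * (∫ y in (0 : ℝ)..2 * π, aσ σ t y * Real.cos y)
          * (∫ y in (0 : ℝ)..2 * π, c σ t y * Real.cos y) + π⁻¹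
          * (∫ y in (0 : ℝ)..2 * π, aσ σ t y * Real.sin y) * (∫ y in (0 : ℝ)..2 * π, c σ t y * Real.sin y)) +
        (π⁻¹ * (∫ y in (0 : ℝ)..2 * π, a σ t y * Real.cos y) * (∫ y in (0 : ℝ)..2 * π, cσ σ t y * Real.cos y)
            + π⁻¹ * (∫ y in (0 : ℝ)..2 * π, a σ t y * Real.sin y) * (∫ y in (0 : ℝ)..2 * π, cσ σ t y * Real.sin y)))
      (fun σ t => hasDerivAt_pairing_sigma haσ hcσ hac hcc haσc hcσc σ t) hW hW' 0 T σ
  have hU'c : Continuous fun σ => ∫ t in (0 : ℝ)..T, ((π⁻¹ * (∫ y in (0 : ℝ)..2 * π, aσ σ t y * Real.cos y)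
      * (∫ y in (0 : ℝ)..2 * π, c σ t y * Real.cos y) + π⁻¹ * (∫ y in (0 : ℝ)..2 * π, aσ σ t y * Real.sin y)
      * (∫ y in (0 : ℝ)..2 * π, c σ t y * Real.sin y)) +
        (π⁻¹ * (∫ y in (0 : ℝ)..2 * π, a σ t y * Real.cos y) * (∫ y in (0 : ℝ)..2 * π, cσ σ t y * Real.cos y)
            + π⁻¹ * (∫ y in (0 : ℝ)..2 * π, a σ t y * Real.sin y)
            * (∫ y in (0 : ℝ)..2 * π, cσ σ t y * Real.sin y))) :=
    intervalIntegral.continuous_parametric_intervalIntegral_of_continuous' hW' _ _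
  exact intervalIntegral.integral_eq_sub_of_hasDerivAt (fun σ _ => hU σ) (hU'c.intervalIntegrable _ _)

/-- **The chart-free hoop inequality on a box** (HOOP-NOTE §4, everything but the chart).  See the module docstring for the data.
`∫_{s₁}^{s₂}∫_0^T t⁻¹∫_θ(a² − b²) ≤ ∫_{s₁}^{s₂}∫_0^T t∫_θ(mr² + mθ² + aσ² + mz²) + ∫_{s₁}^{s₂} π⁻¹((∫a σ 0 cos)²
    + (∫a σ 0 sin)²) dσ`
`+ ∫_0^T∫_θ(a² + c²)(s₁) + ∫_0^T∫_θ(a² + c²)(s₂)`. [HOOP-NOTE §4; folklore] -/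
theorem hoop_box_le {a b c ad aσ cσ mr mθ mz : ℝ → ℝ → ℝ → ℝ} {s₁ s₂ T M : ℝ} (hs : s₁ ≤ s₂) (hT : 0 < T)
    (haθ : ∀ σ t θ, HasDerivAt (fun θ => a σ t θ) (t * mr σ t θ + b σ t θ) θ)
    (hbθ : ∀ σ t θ, HasDerivAt (fun θ => b σ t θ) (t * mθ σ t θ - a σ t θ) θ)
    (hcθ : ∀ σ t θ, HasDerivAt (fun θ => c σ t θ) (t * mz σ t θ) θ)
    (had : ∀ σ t θ, HasDerivAt (fun t => a σ t θ) (ad σ t θ) t)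
    (haσ : ∀ σ t θ, HasDerivAt (fun σ => a σ t θ) (aσ σ t θ) σ)
    (hcσ : ∀ σ t θ, HasDerivAt (fun σ => c σ t θ) (cσ σ t θ) σ)
    (hac : Continuous fun q : ℝ × ℝ × ℝ => a q.1 q.2.1 q.2.2) (hbc : Continuous fun q : ℝ × ℝ × ℝ => b q.1 q.2.1 q.2.2)
    (hcc : Continuous fun q : ℝ × ℝ × ℝ => c q.1 q.2.1 q.2.2) (hadc : Continuous fun q : ℝ × ℝ × ℝ => ad q.1 q.2.1 q.2.2)
    (haσc : Continuous fun q : ℝ × ℝ × ℝ => aσ q.1 q.2.1 q.2.2) (hcσc : Continuous fun q : ℝ × ℝ × ℝ => cσ q.1 q.2.1 q.2.2)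
    (hmrc : Continuous fun q : ℝ × ℝ × ℝ => mr q.1 q.2.1 q.2.2) (hmθc : Continuous fun q : ℝ × ℝ × ℝ => mθ q.1 q.2.1 q.2.2)
    (hmzc : Continuous fun q : ℝ × ℝ × ℝ => mz q.1 q.2.1 q.2.2)
    (haper : ∀ σ t, a σ t (2 * π) = a σ t 0) (hbper : ∀ σ t, b σ t (2 * π) = b σ t 0)
    (hcper : ∀ σ t, c σ t (2 * π) = c σ t 0)
    (hdiv : ∀ σ t θ, ad σ t θ + mθ σ t θ + cσ σ t θ = 0)
    (hM : ∀ σ ∈ Icc s₁ s₂, ∀ t ∈ Ioc 0 T, |t⁻¹ * ∫ θ in (0 : ℝ)..2 * π, (a σ t θ ^ 2 - b σ t θ ^ 2)| ≤ M) :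
    ∫ σ in s₁..s₂, ∫ t in (0 : ℝ)..T, t⁻¹ * ∫ θ in (0 : ℝ)..2 * π, (a σ t θ ^ 2 - b σ t θ ^ 2) ≤
      (∫ σ in s₁..s₂, ∫ t in (0 : ℝ)..T, t * ∫ θ in (0 : ℝ)..2 * π,
          (mr σ t θ ^ 2 + mθ σ t θ ^ 2 + aσ σ t θ ^ 2 + mz σ t θ ^ 2))
        + (∫ σ in s₁..s₂, π⁻¹ * ((∫ y in (0 : ℝ)..2 * π, a σ 0 y * Real.cos y) ^ 2
            + (∫ y in (0 : ℝ)..2 * π, a σ 0 y * Real.sin y) ^ 2))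
        + (∫ t in (0 : ℝ)..T, ∫ θ in (0 : ℝ)..2 * π, (a s₁ t θ ^ 2 + c s₁ t θ ^ 2))
        + (∫ t in (0 : ℝ)..T, ∫ θ in (0 : ℝ)..2 * π, (a s₂ t θ ^ 2 + c s₂ t θ ^ 2)) := by
  -- ### bookkeeping: sections and coefficient functions are continuous
  have sec2 : ∀ {f : ℝ → ℝ → ℝ → ℝ}, (Continuous fun q : ℝ × ℝ × ℝ => f q.1 q.2.1 q.2.2) → ∀ σ, Continuous (uncurry (f σ)) :=
    fun hf σ => hf.comp (continuous_const.prodMk continuous_id)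
  have sec1 : ∀ {f : ℝ → ℝ → ℝ → ℝ}, (Continuous fun q : ℝ × ℝ × ℝ => f q.1 q.2.1 q.2.2) → ∀ σ t, Continuous (f σ t) :=
    fun hf σ t => hf.comp (continuous_const.prodMk (continuous_const.prodMk continuous_id))
  have hCa := continuous_coeff₂ hac continuous_cos
  have hSa := continuous_coeff₂ hac continuous_sin
  have hCc := continuous_coeff₂ hcc continuous_cos
  have hSc := continuous_coeff₂ hcc continuous_sin
  have hCaσ := continuous_coeff₂ haσc continuous_cos
  have hSaσ := continuous_coeff₂ haσc continuous_sin
  have hCcσ := continuous_coeff₂ hcσc continuous_cos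
  have hScσ := continuous_coeff₂ hcσc continuous_sin
  -- the `θ`-integrals of squares, jointly continuous in `(σ, t)`
  have hG : Continuous fun p : ℝ × ℝ => ∫ θ in (0 : ℝ)..2 * π, (a p.1 p.2 θ ^ 2 - b p.1 p.2 θ ^ 2) :=
    continuous_parametric₂_intervalIntegral (F := fun σ t θ => a σ t θ ^ 2 - b σ t θ ^ 2)
      ((hac.pow 2).sub (hbc.pow 2)) _ _
  have hH : Continuous fun p : ℝ × ℝ => ∫ θ in (0 : ℝ)..2 * π, (mr p.1 p.2 θ ^ 2 + mθ p.1 p.2 θ ^ 2) :=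
    continuous_parametric₂_intervalIntegral (F := fun σ t θ => mr σ t θ ^ 2 + mθ σ t θ ^ 2)
      ((hmrc.pow 2).add (hmθc.pow 2)) _ _
  have hX1 : Continuous fun p : ℝ × ℝ => ∫ θ in (0 : ℝ)..2 * π, aσ p.1 p.2 θ ^ 2 :=
    continuous_parametric₂_intervalIntegral (F := fun σ t θ => aσ σ t θ ^ 2) (haσc.pow 2) _ _
  have hX2 : Continuous fun p : ℝ × ℝ => ∫ θ in (0 : ℝ)..2 * π, mz p.1 p.2 θ ^ 2 :=
    continuous_parametric₂_intervalIntegral (F := fun σ t θ => mz σ t θ ^ 2) (hmzc.pow 2) _ _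
  have hAC : Continuous fun p : ℝ × ℝ => ∫ θ in (0 : ℝ)..2 * π, (a p.1 p.2 θ ^ 2 + c p.1 p.2 θ ^ 2) :=
    continuous_parametric₂_intervalIntegral (F := fun σ t θ => a σ t θ ^ 2 + c σ t θ ^ 2)
      ((hac.pow 2).add (hcc.pow 2)) _ _
  -- ### step 1: the slice inequality at every height `σ ∈ [s₁, s₂]`
  have hslice : ∀ σ ∈ Icc s₁ s₂,
      ∫ t in (0 : ℝ)..T, t⁻¹ * ∫ θ in (0 : ℝ)..2 * π, (a σ t θ ^ 2 - b σ t θ ^ 2) ≤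
        (∫ t in (0 : ℝ)..T, t * ∫ θ in (0 : ℝ)..2 * π, (mr σ t θ ^ 2 + mθ σ t θ ^ 2))
          + π⁻¹ * ((∫ y in (0 : ℝ)..2 * π, a σ 0 y * Real.cos y) ^ 2
              + (∫ y in (0 : ℝ)..2 * π, a σ 0 y * Real.sin y) ^ 2)
          - π⁻¹ * ((∫ y in (0 : ℝ)..2 * π, a σ T y * Real.cos y) ^ 2
              + (∫ y in (0 : ℝ)..2 * π, a σ T y * Real.sin y) ^ 2)
          - 2 * ∫ t in (0 : ℝ)..T, ∫ θ in (0 : ℝ)..2 * π,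
              (π⁻¹ * (∫ y in (0 : ℝ)..2 * π, a σ t y * Real.cos y) * Real.cos θ +
              π⁻¹ * (∫ y in (0 : ℝ)..2 * π, a σ t y * Real.sin y) * Real.sin θ) * cσ σ t θ := by
    intro σ hσ
    have hint : IntervalIntegrable (fun t => t⁻¹ * ∫ θ in (0 : ℝ)..2 * π, (a σ t θ ^ 2 - b σ t θ ^ 2)) volume 0 T :=
      intervalIntegrable_inv_mul_of_bound (G := fun t => ∫ θ in (0 : ℝ)..2 * π, (a σ t θ ^ 2 - b σ t θ ^ 2))
        (hG.comp (continuous_const.prodMk continuous_id)) hT.le (hM σ hσ)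
    exact hoop_slice_le_frame hT (haθ σ) (hbθ σ) (had σ) (sec2 hac σ) (sec2 hbc σ) (sec2 hmrc σ) (sec2 hmθc σ)
      (sec2 hadc σ) (sec2 hcσc σ) (haper σ) (hbper σ) (hdiv σ) hint
  -- ### step 2: the `β = cσ` term is the second bracket of `∂_σ W`
  have hK : ∀ σ, (∫ t in (0 : ℝ)..T, ∫ θ in (0 : ℝ)..2 * π,
      (π⁻¹ * (∫ y in (0 : ℝ)..2 * π, a σ t y * Real.cos y) * Real.cos θ +
              π⁻¹ * (∫ y in (0 : ℝ)..2 * π, a σ t y * Real.sin y) * Real.sin θ) * cσ σ t θ) =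
      ∫ t in (0 : ℝ)..T, (π⁻¹ * (∫ y in (0 : ℝ)..2 * π, a σ t y * Real.cos y)
          * (∫ y in (0 : ℝ)..2 * π, cσ σ t y * Real.cos y) + π⁻¹
          * (∫ y in (0 : ℝ)..2 * π, a σ t y * Real.sin y) * (∫ y in (0 : ℝ)..2 * π, cσ σ t y * Real.sin y)) := by
    intro σ
    refine intervalIntegral.integral_congr fun t _ => ?_
    rw [integral_firstMode_mul (sec1 hcσc σ t)]
  -- ### step 3: integrate the slice inequality over `σ ∈ [s₁, s₂]`
  have hLc : ContinuousOn (fun σ => ∫ t in (0 : ℝ)..T, t⁻¹ * ∫ θ in (0 : ℝ)..2 * π,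
      (a σ t θ ^ 2 - b σ t θ ^ 2)) (Icc s₁ s₂) :=
    continuousOn_intervalIntegral_inv_mul_of_bound
      (G := fun σ t => ∫ θ in (0 : ℝ)..2 * π, (a σ t θ ^ 2 - b σ t θ ^ 2)) hG hT.le hM
  have hIcc : uIcc s₁ s₂ = Icc s₁ s₂ := uIcc_of_le hs
  have hIL : IntervalIntegrable (fun σ => ∫ t in (0 : ℝ)..T, t⁻¹ * ∫ θ in (0 : ℝ)..2 * π,
      (a σ t θ ^ 2 - b σ t θ ^ 2)) volume s₁ s₂ :=
    ContinuousOn.intervalIntegrable (by rw [hIcc]; exact hLc)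
  have hHc' : Continuous (uncurry fun σ t => t * ∫ θ in (0 : ℝ)..2 * π, (mr σ t θ ^ 2 + mθ σ t θ ^ 2)) :=
    continuous_snd.mul hH
  have hHc : Continuous fun σ => ∫ t in (0 : ℝ)..T, t * ∫ θ in (0 : ℝ)..2 * π, (mr σ t θ ^ 2 + mθ σ t θ ^ 2) :=
    intervalIntegral.continuous_parametric_intervalIntegral_of_continuous' hHc' _ _
  have hE0c : Continuous fun σ => π⁻¹ * ((∫ y in (0 : ℝ)..2 * π, a σ 0 y * Real.cos y) ^ 2
      + (∫ y in (0 : ℝ)..2 * π, a σ 0 y * Real.sin y) ^ 2) :=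
    continuous_const.mul (((hCa.comp (continuous_id.prodMk continuous_const)).pow 2).add
      ((hSa.comp (continuous_id.prodMk continuous_const)).pow 2))
  have hETc : Continuous fun σ => π⁻¹ * ((∫ y in (0 : ℝ)..2 * π, a σ T y * Real.cos y) ^ 2
      + (∫ y in (0 : ℝ)..2 * π, a σ T y * Real.sin y) ^ 2) :=
    continuous_const.mul (((hCa.comp (continuous_id.prodMk continuous_const)).pow 2).add
      ((hSa.comp (continuous_id.prodMk continuous_const)).pow 2))
  have hW2c : Continuous (uncurry fun σ t => π⁻¹ * (∫ y in (0 : ℝ)..2 * π, a σ t y * Real.cos y)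
      * (∫ y in (0 : ℝ)..2 * π, cσ σ t y * Real.cos y) + π⁻¹ * (∫ y in (0 : ℝ)..2 * π, a σ t y * Real.sin y)
      * (∫ y in (0 : ℝ)..2 * π, cσ σ t y * Real.sin y)) :=
    ((continuous_const.mul hCa).mul hCcσ).add ((continuous_const.mul hSa).mul hScσ)
  have hW1c : Continuous (uncurry fun σ t => π⁻¹ * (∫ y in (0 : ℝ)..2 * π, aσ σ t y * Real.cos y)
      * (∫ y in (0 : ℝ)..2 * π, c σ t y * Real.cos y) + π⁻¹ * (∫ y in (0 : ℝ)..2 * π, aσ σ t y * Real.sin y)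
      * (∫ y in (0 : ℝ)..2 * π, c σ t y * Real.sin y)) :=
    ((continuous_const.mul hCaσ).mul hCc).add ((continuous_const.mul hSaσ).mul hSc)
  have hKc : Continuous fun σ => ∫ t in (0 : ℝ)..T, (π⁻¹ * (∫ y in (0 : ℝ)..2 * π, a σ t y * Real.cos y)
      * (∫ y in (0 : ℝ)..2 * π, cσ σ t y * Real.cos y) + π⁻¹ * (∫ y in (0 : ℝ)..2 * π, a σ t y * Real.sin y)
      * (∫ y in (0 : ℝ)..2 * π, cσ σ t y * Real.sin y)) :=
    intervalIntegral.continuous_parametric_intervalIntegral_of_continuous' hW2c _ _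
  have hK1c : Continuous fun σ => ∫ t in (0 : ℝ)..T, (π⁻¹ * (∫ y in (0 : ℝ)..2 * π, aσ σ t y * Real.cos y)
      * (∫ y in (0 : ℝ)..2 * π, c σ t y * Real.cos y) + π⁻¹ * (∫ y in (0 : ℝ)..2 * π, aσ σ t y * Real.sin y)
      * (∫ y in (0 : ℝ)..2 * π, c σ t y * Real.sin y)) :=
    intervalIntegral.continuous_parametric_intervalIntegral_of_continuous' hW1c _ _
  have hIH := hHc.intervalIntegrable (μ := volume) s₁ s₂
  have hIE0 := hE0c.intervalIntegrable (μ := volume) s₁ s₂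
  have hIET := hETc.intervalIntegrable (μ := volume) s₁ s₂
  have hIK : IntervalIntegrable (fun σ => 2 * ∫ t in (0 : ℝ)..T, (π⁻¹
      * (∫ y in (0 : ℝ)..2 * π, a σ t y * Real.cos y) * (∫ y in (0 : ℝ)..2 * π, cσ σ t y * Real.cos y) + π⁻¹
      * (∫ y in (0 : ℝ)..2 * π, a σ t y * Real.sin y)
      * (∫ y in (0 : ℝ)..2 * π, cσ σ t y * Real.sin y))) volume s₁ s₂ :=
    (continuous_const.mul hKc).intervalIntegrable s₁ s₂
  have hmono := intervalIntegral.integral_mono_on hs hIL (((hIH.add hIE0).sub hIET).sub hIK) fun σ hσ => by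
    have h := hslice σ hσ
    rw [hK σ] at h
    exact h
  rw [intervalIntegral.integral_sub ((hIH.add hIE0).sub hIET) hIK, intervalIntegral.integral_sub (hIH.add hIE0) hIET,
    intervalIntegral.integral_add hIH hIE0, intervalIntegral.integral_const_mul (2 : ℝ)] at hmono
  -- ### step 4: `−∫ E_σ(T) ≤ 0`
  have hET0 : 0 ≤ ∫ σ in s₁..s₂, π⁻¹ * ((∫ y in (0 : ℝ)..2 * π, a σ T y * Real.cos y) ^ 2
      + (∫ y in (0 : ℝ)..2 * π, a σ T y * Real.sin y) ^ 2) :=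
    intervalIntegral.integral_nonneg hs fun σ _ => by positivity
  -- ### step 5: the `β`-term by parts in `σ`
  have hftc := pairing_sigma_ftc haσ hcσ hac hcc haσc hcσc s₁ s₂ T
  have hsplitK : (∫ σ in s₁..s₂, ∫ t in (0 : ℝ)..T,
      ((π⁻¹ * (∫ y in (0 : ℝ)..2 * π, aσ σ t y * Real.cos y) * (∫ y in (0 : ℝ)..2 * π, c σ t y * Real.cos y)
          + π⁻¹ * (∫ y in (0 : ℝ)..2 * π, aσ σ t y * Real.sin y) * (∫ y in (0 : ℝ)..2 * π, c σ t y * Real.sin y)) +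
        (π⁻¹ * (∫ y in (0 : ℝ)..2 * π, a σ t y * Real.cos y) * (∫ y in (0 : ℝ)..2 * π, cσ σ t y * Real.cos y)
            + π⁻¹ * (∫ y in (0 : ℝ)..2 * π, a σ t y * Real.sin y)
            * (∫ y in (0 : ℝ)..2 * π, cσ σ t y * Real.sin y)))) =
      (∫ σ in s₁..s₂, ∫ t in (0 : ℝ)..T, (π⁻¹ * (∫ y in (0 : ℝ)..2 * π, aσ σ t y * Real.cos y)
          * (∫ y in (0 : ℝ)..2 * π, c σ t y * Real.cos y) + π⁻¹
          * (∫ y in (0 : ℝ)..2 * π, aσ σ t y * Real.sin y) * (∫ y in (0 : ℝ)..2 * π, c σ t y * Real.sin y))) +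
        ∫ σ in s₁..s₂, ∫ t in (0 : ℝ)..T, (π⁻¹ * (∫ y in (0 : ℝ)..2 * π, a σ t y * Real.cos y)
            * (∫ y in (0 : ℝ)..2 * π, cσ σ t y * Real.cos y) + π⁻¹
            * (∫ y in (0 : ℝ)..2 * π, a σ t y * Real.sin y) * (∫ y in (0 : ℝ)..2 * π, cσ σ t y * Real.sin y)) := by
    rw [← intervalIntegral.integral_add (hK1c.intervalIntegrable _ _) (hKc.intervalIntegrable _ _)]
    refine intervalIntegral.integral_congr fun σ _ => ?_
    exact intervalIntegral.integral_add
      ((hW1c.comp (continuous_const.prodMk continuous_id)).intervalIntegrable _ _)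
      ((hW2c.comp (continuous_const.prodMk continuous_id)).intervalIntegrable _ _)
  -- ### step 6: the cross term `2∫∫ (first bracket) ≤ ∫∫ t(∫aσ² + ∫mz²)`
  have hXc : Continuous (uncurry fun σ t => t * ((∫ θ in (0 : ℝ)..2 * π, aσ σ t θ ^ 2) +
      ∫ θ in (0 : ℝ)..2 * π, mz σ t θ ^ 2)) := continuous_snd.mul (hX1.add hX2)
  have hIX := (intervalIntegral.continuous_parametric_intervalIntegral_of_continuous' (μ := volume) hXc 0 T).intervalIntegrable
    (μ := volume) s₁ s₂
  have hcross : 2 * (∫ σ in s₁..s₂, ∫ t in (0 : ℝ)..T, (π⁻¹ * (∫ y in (0 : ℝ)..2 * π, aσ σ t y * Real.cos y)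
      * (∫ y in (0 : ℝ)..2 * π, c σ t y * Real.cos y) + π⁻¹ * (∫ y in (0 : ℝ)..2 * π, aσ σ t y * Real.sin y)
      * (∫ y in (0 : ℝ)..2 * π, c σ t y * Real.sin y))) ≤
      ∫ σ in s₁..s₂, ∫ t in (0 : ℝ)..T, t * ((∫ θ in (0 : ℝ)..2 * π, aσ σ t θ ^ 2) +
        ∫ θ in (0 : ℝ)..2 * π, mz σ t θ ^ 2) := by
    rw [← intervalIntegral.integral_const_mul (2 : ℝ)]
    refine intervalIntegral.integral_mono_on hs ((continuous_const.mul hK1c).intervalIntegrable _ _) hIX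
      fun σ _ => ?_
    rw [← intervalIntegral.integral_const_mul (2 : ℝ)]
    refine intervalIntegral.integral_mono_on hT.le
      ((continuous_const.mul (hW1c.comp (continuous_const.prodMk continuous_id))).intervalIntegrable _ _)
      ((hXc.comp (continuous_const.prodMk continuous_id)).intervalIntegrable _ _) fun t ht => ?_
    have h := two_mul_abs_pairing_deriv_le (sec1 haσc σ t) (hcθ σ t) (sec1 hmzc σ t) (hcper σ t) ht.1
    linarith [h, le_abs_self (π⁻¹ * (∫ y in (0 : ℝ)..2 * π, aσ σ t y * Real.cos y)
        * (∫ y in (0 : ℝ)..2 * π, c σ t y * Real.cos y) + π⁻¹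
        * (∫ y in (0 : ℝ)..2 * π, aσ σ t y * Real.sin y) * (∫ y in (0 : ℝ)..2 * π, c σ t y * Real.sin y))]
  -- ### step 7: the end discs `2|U(s)| ≤ B(s)`
  have hend : ∀ s, 2 * |∫ t in (0 : ℝ)..T, (π⁻¹ * (∫ y in (0 : ℝ)..2 * π, a s t y * Real.cos y)
      * (∫ y in (0 : ℝ)..2 * π, c s t y * Real.cos y) + π⁻¹ * (∫ y in (0 : ℝ)..2 * π, a s t y * Real.sin y)
      * (∫ y in (0 : ℝ)..2 * π, c s t y * Real.sin y))| ≤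
      (∫ t in (0 : ℝ)..T, ∫ θ in (0 : ℝ)..2 * π, (a s t θ ^ 2 + c s t θ ^ 2)) := by
    intro s
    have hb := intervalIntegral.norm_integral_le_of_norm_le (μ := volume) (a := 0) (b := T)
      (f := fun t => 2 * (π⁻¹ * (∫ y in (0 : ℝ)..2 * π, a s t y * Real.cos y)
          * (∫ y in (0 : ℝ)..2 * π, c s t y * Real.cos y) + π⁻¹
          * (∫ y in (0 : ℝ)..2 * π, a s t y * Real.sin y) * (∫ y in (0 : ℝ)..2 * π, c s t y * Real.sin y)))
      (g := fun t => ∫ θ in (0 : ℝ)..2 * π, (a s t θ ^ 2 + c s t θ ^ 2)) hT.le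
      (Eventually.of_forall fun t _ => by
        rw [Real.norm_eq_abs, abs_mul, abs_two]
        have i1 : IntervalIntegrable (fun θ => a s t θ ^ 2) volume 0 (2 * π) :=
          ((sec1 hac s t).pow 2).intervalIntegrable _ _
        have i2 : IntervalIntegrable (fun θ => c s t θ ^ 2) volume 0 (2 * π) :=
          ((sec1 hcc s t).pow 2).intervalIntegrable _ _
        have h := two_mul_abs_pairing_le (sec1 hac s t) (sec1 hcc s t)
        rw [← intervalIntegral.integral_add i1 i2] at h
        exact h)
      ((hAC.comp (continuous_const.prodMk continuous_id)).intervalIntegrable _ _)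
    rw [Real.norm_eq_abs, intervalIntegral.integral_const_mul (2 : ℝ), abs_mul, abs_two] at hb
    exact hb
  have hend₁ := hend s₁
  have hend₂ := hend s₂
  -- ### step 8: recombine the Frobenius pieces
  have hsum : (∫ σ in s₁..s₂, ∫ t in (0 : ℝ)..T, t * ∫ θ in (0 : ℝ)..2 * π, (mr σ t θ ^ 2 + mθ σ t θ ^ 2)) +
      (∫ σ in s₁..s₂, ∫ t in (0 : ℝ)..T, t * ((∫ θ in (0 : ℝ)..2 * π, aσ σ t θ ^ 2) +
        ∫ θ in (0 : ℝ)..2 * π, mz σ t θ ^ 2)) =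
      ∫ σ in s₁..s₂, ∫ t in (0 : ℝ)..T, t * ∫ θ in (0 : ℝ)..2 * π,
          (mr σ t θ ^ 2 + mθ σ t θ ^ 2 + aσ σ t θ ^ 2 + mz σ t θ ^ 2) := by
    rw [← intervalIntegral.integral_add hIH hIX]
    refine intervalIntegral.integral_congr fun σ _ => ?_
    have j1 : IntervalIntegrable (fun t => t * ∫ θ in (0 : ℝ)..2 * π, (mr σ t θ ^ 2 + mθ σ t θ ^ 2)) volume 0 T :=
      (hHc'.comp (continuous_const.prodMk continuous_id)).intervalIntegrable _ _
    have j2 : IntervalIntegrable (fun t => t * ((∫ θ in (0 : ℝ)..2 * π, aσ σ t θ ^ 2) +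
        ∫ θ in (0 : ℝ)..2 * π, mz σ t θ ^ 2)) volume 0 T :=
      (hXc.comp (continuous_const.prodMk continuous_id)).intervalIntegrable _ _
    show (∫ t in (0 : ℝ)..T, t * ∫ θ in (0 : ℝ)..2 * π, (mr σ t θ ^ 2 + mθ σ t θ ^ 2)) +
        (∫ t in (0 : ℝ)..T, t * ((∫ θ in (0 : ℝ)..2 * π, aσ σ t θ ^ 2) + ∫ θ in (0 : ℝ)..2 * π, mz σ t θ ^ 2)) =
      ∫ t in (0 : ℝ)..T, t * ∫ θ in (0 : ℝ)..2 * π, (mr σ t θ ^ 2 + mθ σ t θ ^ 2 + aσ σ t θ ^ 2 + mz σ t θ ^ 2)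
    rw [← intervalIntegral.integral_add j1 j2]
    refine intervalIntegral.integral_congr fun t _ => ?_
    have i12 : IntervalIntegrable (fun θ => mr σ t θ ^ 2 + mθ σ t θ ^ 2) volume 0 (2 * π) :=
      (((sec1 hmrc σ t).pow 2).add ((sec1 hmθc σ t).pow 2)).intervalIntegrable _ _
    have i3 : IntervalIntegrable (fun θ => aσ σ t θ ^ 2) volume 0 (2 * π) :=
      ((sec1 haσc σ t).pow 2).intervalIntegrable _ _
    have i4 : IntervalIntegrable (fun θ => mz σ t θ ^ 2) volume 0 (2 * π) :=
      ((sec1 hmzc σ t).pow 2).intervalIntegrable _ _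
    have e : ∫ θ in (0 : ℝ)..2 * π, (mr σ t θ ^ 2 + mθ σ t θ ^ 2 + aσ σ t θ ^ 2 + mz σ t θ ^ 2) =
        (∫ θ in (0 : ℝ)..2 * π, (mr σ t θ ^ 2 + mθ σ t θ ^ 2)) +
          ((∫ θ in (0 : ℝ)..2 * π, aσ σ t θ ^ 2) + ∫ θ in (0 : ℝ)..2 * π, mz σ t θ ^ 2) := by
      rw [← intervalIntegral.integral_add i3 i4, ← intervalIntegral.integral_add i12 (i3.add i4)]
      exact intervalIntegral.integral_congr fun θ _ => by ring
    show t * (∫ θ in (0 : ℝ)..2 * π, (mr σ t θ ^ 2 + mθ σ t θ ^ 2)) +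
        t * ((∫ θ in (0 : ℝ)..2 * π, aσ σ t θ ^ 2) + ∫ θ in (0 : ℝ)..2 * π, mz σ t θ ^ 2) =
      t * ∫ θ in (0 : ℝ)..2 * π, (mr σ t θ ^ 2 + mθ σ t θ ^ 2 + aσ σ t θ ^ 2 + mz σ t θ ^ 2)
    rw [e]
    ring
  -- ### conclusion
  have habs₁ := le_abs_self (∫ t in (0 : ℝ)..T, (π⁻¹ * (∫ y in (0 : ℝ)..2 * π, a s₁ t y * Real.cos y)
      * (∫ y in (0 : ℝ)..2 * π, c s₁ t y * Real.cos y) + π⁻¹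
      * (∫ y in (0 : ℝ)..2 * π, a s₁ t y * Real.sin y) * (∫ y in (0 : ℝ)..2 * π, c s₁ t y * Real.sin y)))
  have habs₂ := neg_abs_le (∫ t in (0 : ℝ)..T, (π⁻¹ * (∫ y in (0 : ℝ)..2 * π, a s₂ t y * Real.cos y)
      * (∫ y in (0 : ℝ)..2 * π, c s₂ t y * Real.cos y) + π⁻¹
      * (∫ y in (0 : ℝ)..2 * π, a s₂ t y * Real.sin y) * (∫ y in (0 : ℝ)..2 * π, c s₂ t y * Real.sin y)))
  linarith [hmono, hET0, hftc, hsplitK, hcross, hend₁, hend₂, hsum, habs₁, habs₂]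

end Summit.NavierStokesRegularity.NavierStokesRegularity.Theorems.PowerGaugeEulerLiouville.HoopCore

end
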